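import Summits.QuantumFields.BalabanUV.T4Continuum.Support.NE7FlatHkOrthogonal
import Summits.QuantumFields.BalabanUV.T4Continuum.Support.NE7FlatHkCurlLetter
import Summits.QuantumFields.BalabanUV.T4Continuum.Support.NE3SmoothRightInverseBounds
import Summits.QuantumFields.BalabanUV.T4Continuum.Support.NE3CpushGaugeCovariance
import HarnessLib

/-!
# NE7StraightDatumTorus — THE STRAIGHT BLOCK AVERAGE OF A PERIODIC T4 DIRECTION READ ON lit-balaban's TORUS: entry by entry,
# `Q_k z_{ii′} = n₀⁻¹·[dirIter L (k+1) 1 Z + dPot (framePot L (k+1) Z)]_{ii′}`, hence `|Q_k z_{ii′}| ≤ (β + 2d(n₀−1)·b)∕n₀` from the COMB datum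
# `‖dirIter L (k+1) 1 Z‖ ≤ β` and the sup `‖Z‖ ≤ b` (`NE7StraightDatumTorus`)

Cell `pub-balaban`, lineage `t4-ne7-p1` (CRUX PROVER NE7 #1 = OWNER of row NE7), gen 74; brick T1 of ROAD v4 (`t4/b2b-balaban-t4-ne7-p1-g74/REP-FLAT-ROAD-v4.md`).
WHY.  The intrinsic letters of the exact B5-Landau gauge (`NE7LandauExactSup`: `|z| ≤ C·sup|F(z)| + C′·sup|Q*Qz|`, [B5] (1.69)) are in the STRAIGHT block average
`Q_k` of [B5] (1.18) (`B5Block118.QvOp`), while the T4 programme's level datum is the COMB-covariant average of [B7] (42) linearised at the flat background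
(`dirIter L (k+1) 1 = cpushIter L k 1 = (Tcoarse L)^{k+1}`).  Row NE3's frame identity `(Tcoarse L)^{k+1} Y = (Qcoarse L)^{k+1} Y − dPot (framePot L (k+1) Y)`
(`NE3TangentFlatStructure.iterate_Tcoarse_eq`) and gen 70's one-shot bridge `linQ n₀ (A ∘ toT) (n₀•rep y) = n₀·Q_k A` (`NE7FlatAverageBridge.linQ_pullback_eq`) give the
dictionary of this file: the straight average is the comb datum PLUS the frame coboundary, divided by `n₀ = L^{k+1}`.  (For a T4-TANGENT direction the comb datum
vanishes and this is gen 70's `NE7FlatHkOrthogonal.qvOp_entry_coarse_exact`.)  ROAD v4's located obstruction (memo §1): the frame coboundary is of the size of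
`‖Z‖` and no better (exact-gauge curl-free modes with comb datum `= sup∕n₀` exist), so at the TOP of the road the straight datum is taken as an A-PRIORI input of
size `O(‖Z‖)` — this file's §2 bound — and not as something the induction resets.
CONTENT ([folklore]; 0 def, 0 sorry; dimension `d`, `L ≥ 1`, every `k`, every period multiplier `P ≥ 1`).  §1 `qvOp_entry_eq` (the identity); §2 `norm_qvOp_entry_le`
(the bound through `norm_framePot_le_of_block`), `norm_qvOp_entry_le_dirIter` (the same with `dirIter L (k+1)`).
HONEST FRAMING (page 1): linear bookkeeping at the flat background BY NAME over the tree; nothing of Bałaban's asserted ([B5] (1.18), [B7] (42) are text locations);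
REP♭ NOT proved; (APE) NOT proved; NE7 NOT PRINTED ∕ NOT PROVED (0∕1); spine PROVED 0∕9; rung (B)+1 finite T⁴ — NOT infinite volume, NOT mass gap, NOT BetaPertH,
NOT Clay.  PLACEMENT: our lemma, under `Summits/QuantumFields/BalabanUV/`.
Continuum YM on T⁴ ⇐ BetaPertH ∧ nine spine estimates (0/9 proved); BetaPertH ⇐ (D1) ∧ (D4) ∧ CAP+tail; G-an2-4 gates asym, D1 and NE2/3/4.
-/

set_option autoImplicit false

open scoped BigOperators Matrix Matrix.Norms.L2Operator
open Finset

namespace Summit.QuantumFields.BalabanUV.T4Continuum.NE7StraightDatumTorus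

open Literature.MathematicalPhysics.QuantumFieldTheory.Balaban1983to89
open B7Prop1Explicit (Site e e_apply)
open AveragingDeficitPeriodicCounting (IsPeriodicDir)
open B5Prop11Plancherel (Tor fine unitVec)
open B5Block118 (QvOp)
open B6LowerBound2153Torus (toT rep toT_rep)
open BlockAveragePushDirSplit (flat)
open NE3TangentNoGoWords (dPot)
open NE3TangentFlatStructure (framePot iterate_Tcoarse_eq framePot_add_period)
open NE3SmoothRightInverseFlat (cpushIter_flat iterate_Qcoarse_apply)
open NE3SmoothRightInverseBounds (norm_framePot_le_of_block)
open NE3TangentCovariantTower (dirIter)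
open NE3CpushGaugeCovariance (dirIter_succ_eq_cpushIter)
open NE7FlatAverageBridge (linQ_pullback_eq)
open NE7FlatHkRightInverse (linQ_apply_entry)
open NE7FlatHkOrthogonal (applyS_rep_toT)
open NE7TorusBoxDictionary (toT_add_e' apply_rep_toT')
open ReplicationRightInverse (cpushIter)
open Literature.Computability.QuantumComplexity.SolovayKitaev (norm_apply_le_norm)

noncomputable section

variable {d : ℕ} {n : Type*} [Fintype n] [DecidableEq n]

/-! ## §1 The identity -/

/-- **THE STRAIGHT AVERAGE OF A PERIODIC DIRECTION, ENTRYWISE, IS THE COMB DATUM PLUS THE FRAME COBOUNDARY, OVER `n₀`**: for `Y` `(n₀·P)`-periodic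
(`n₀ = L^{j+1}`) and every entry `(i,i′)`, `Q_k y_{ii′}(t,κ) = n₀⁻¹·(cpushIter L j 1 Y)(rep t, κ)_{ii′} + n₀⁻¹·(framePot L (j+1) Y (rep (t+u_κ)) − framePot L (j+1) Y (rep t))_{ii′}`.
[folklore] -/
theorem qvOp_entry_eq {L : ℕ} (hL : 1 ≤ L) (j : ℕ) {P : ℕ} [NeZero P] [NeZero (L ^ (j + 1))]
    {Y : Site d → Fin d → Matrix n n ℂ} (hYP : IsPeriodicDir Y ((L ^ (j + 1) * P : ℕ) : ℤ)) (i i' : n) (t : Tor (fun _ : Fin d => P)) (κ : Fin d) :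
    (QvOp (L ^ (j + 1)) (fun _ : Fin d => P) *ᵥ
        fun p : Tor (fine (L ^ (j + 1)) (fun _ : Fin d => P)) × Fin d =>
          Y (rep (fine (L ^ (j + 1)) (fun _ : Fin d => P)) p.1) p.2 i i') (t, κ)
      = ((L ^ (j + 1) : ℕ) : ℂ)⁻¹ * cpushIter L j (flat (d := d) (n := n)) Y (rep (fun _ : Fin d => P) t) κ i i'
        + ((L ^ (j + 1) : ℕ) : ℂ)⁻¹ * (framePot L (j + 1) Y (rep (fun _ : Fin d => P) (t + unitVec (fun _ : Fin d => P) κ)) i i'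
            - framePot L (j + 1) Y (rep (fun _ : Fin d => P) t) i i') := by
  have hnc : ((L ^ (j + 1) : ℕ) : ℂ) ≠ 0 := by exact_mod_cast NeZero.ne (L ^ (j + 1))
  haveI hNP : NeZero (L ^ (j + 1) * P) := ⟨Nat.mul_ne_zero (NeZero.ne (L ^ (j + 1))) (NeZero.ne P)⟩
  -- the comb datum is the straight average minus the frame coboundary
  have hT : cpushIter L j (flat (d := d) (n := n)) Y (rep (fun _ : Fin d => P) t) κ
      = (NE3TangentFlatStructure.Qcoarse L)^[j + 1] Y (rep (fun _ : Fin d => P) t) κ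
        - dPot (framePot L (j + 1) Y) (rep (fun _ : Fin d => P) t) κ := by
    rw [cpushIter_flat hL]; exact iterate_Tcoarse_eq hL (j + 1) Y _ κ
  have hQ : (NE3TangentFlatStructure.Qcoarse L)^[j + 1] Y (rep (fun _ : Fin d => P) t) κ i i'
      = B7Prop3Flat.linQ (L ^ (j + 1)) (fun x μ => Y x μ i i') (((L ^ (j + 1) : ℕ) : ℤ) • rep (fun _ : Fin d => P) t) κ := by
    rw [iterate_Qcoarse_apply, linQ_apply_entry]
  -- the entry field is the pull-back of its torus restriction
  have hpull : (fun (x : Site d) (μ : Fin d) => Y x μ i i')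
      = fun (x : Site d) (μ : Fin d) => (fun p : Tor (fine (L ^ (j + 1)) (fun _ : Fin d => P)) × Fin d =>
          Y (rep (fine (L ^ (j + 1)) (fun _ : Fin d => P)) p.1) p.2 i i') (toT (fine (L ^ (j + 1)) (fun _ : Fin d => P)) x, μ) := by
    funext x μ
    exact (apply_rep_toT' (P := L ^ (j + 1) * P) hYP x μ ▸ rfl)
  have hlin := linQ_pullback_eq (L ^ (j + 1)) (fun _ : Fin d => P)
    (fun p : Tor (fine (L ^ (j + 1)) (fun _ : Fin d => P)) × Fin d => Y (rep (fine (L ^ (j + 1)) (fun _ : Fin d => P)) p.1) p.2 i i') t κ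
  rw [← hpull, ← hQ] at hlin
  -- `hlin : Qcoarse^{j+1} Y (rep t) κ i i' = n₀ * (QvOp y)(t,κ)`; the frame coboundary read on the coarse torus
  have hGP : ∀ (z : Site d) (τ : Fin d), framePot L (j + 1) Y (z + (P : ℤ) • e τ) = framePot L (j + 1) Y z :=
    framePot_add_period L (j + 1) Y (P := (P : ℤ)) (fun y τ μ => by
      have := hYP y τ μ; push_cast at this; exact this)
  have hG1 : framePot L (j + 1) Y (rep (fun _ : Fin d => P) t + e κ)
      = framePot L (j + 1) Y (rep (fun _ : Fin d => P) (t + unitVec (fun _ : Fin d => P) κ)) := by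
    rw [← applyS_rep_toT (P := P) hGP (rep (fun _ : Fin d => P) t + e κ), toT_add_e', toT_rep]
  have hd : dPot (framePot L (j + 1) Y) (rep (fun _ : Fin d => P) t) κ i i'
      = framePot L (j + 1) Y (rep (fun _ : Fin d => P) (t + unitVec (fun _ : Fin d => P) κ)) i i'
        - framePot L (j + 1) Y (rep (fun _ : Fin d => P) t) i i' := by
    simp only [dPot, hG1, Matrix.sub_apply]
  have hc : cpushIter L j (flat (d := d) (n := n)) Y (rep (fun _ : Fin d => P) t) κ i i'
      = ((L ^ (j + 1) : ℕ) : ℂ) * (QvOp (L ^ (j + 1)) (fun _ : Fin d => P) *ᵥ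
          fun p : Tor (fine (L ^ (j + 1)) (fun _ : Fin d => P)) × Fin d => Y (rep (fine (L ^ (j + 1)) (fun _ : Fin d => P)) p.1) p.2 i i') (t, κ)
        - (framePot L (j + 1) Y (rep (fun _ : Fin d => P) (t + unitVec (fun _ : Fin d => P) κ)) i i'
            - framePot L (j + 1) Y (rep (fun _ : Fin d => P) t) i i') := by
    rw [hT, Matrix.sub_apply, hlin, hd]
  rw [hc]
  field_simp
  ring

/-! ## §2 The bound -/

/-- **THE STRAIGHT DATUM FROM THE COMB DATUM AND THE SUP** (comb form): with `‖cpushIter L j 1 Y (z,κ)‖ ≤ β` and `‖Y(y,κ)‖ ≤ b` everywhere,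
`‖Q_k y_{ii′}(t,κ)‖ ≤ (β + 2d(n₀−1)·b)∕n₀` for every entry — the frame potential of a field of sup `b` is `≤ d(n₀−1)b` blockwise (row NE3). [folklore] -/
theorem norm_qvOp_entry_le {L : ℕ} (hL : 1 ≤ L) (j : ℕ) {P : ℕ} [NeZero P] [NeZero (L ^ (j + 1))]
    {Y : Site d → Fin d → Matrix n n ℂ} (hYP : IsPeriodicDir Y ((L ^ (j + 1) * P : ℕ) : ℤ))
    {β : ℝ} (hβ : ∀ (z : Site d) (κ : Fin d), ‖cpushIter L j (flat (d := d) (n := n)) Y z κ‖ ≤ β)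
    {b : ℝ} (hb : ∀ (y : Site d) (κ : Fin d), ‖Y y κ‖ ≤ b) (i i' : n) (t : Tor (fun _ : Fin d => P)) (κ : Fin d) :
    ‖(QvOp (L ^ (j + 1)) (fun _ : Fin d => P) *ᵥ
        fun p : Tor (fine (L ^ (j + 1)) (fun _ : Fin d => P)) × Fin d =>
          Y (rep (fine (L ^ (j + 1)) (fun _ : Fin d => P)) p.1) p.2 i i') (t, κ)‖
      ≤ (β + 2 * ((d : ℝ) * (((L ^ (j + 1) : ℕ) : ℝ) - 1) * b)) / ((L ^ (j + 1) : ℕ) : ℝ) := by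
  have hn0 : (0 : ℝ) < ((L ^ (j + 1) : ℕ) : ℝ) := by exact_mod_cast Nat.pos_of_ne_zero (NeZero.ne (L ^ (j + 1)))
  have hb0 : 0 ≤ b := (norm_nonneg _).trans (hb 0 κ)
  have hpowZ : ((L : ℤ) ^ (j + 1)) = ((L ^ (j + 1) : ℕ) : ℤ) := by push_cast; ring
  have hpowR : ((L : ℝ) ^ (j + 1)) = ((L ^ (j + 1) : ℕ) : ℝ) := by push_cast; ring
  -- the frame potential blockwise
  have hF : ∀ z : Site d, ‖framePot L (j + 1) Y z‖ ≤ (d : ℝ) * (((L ^ (j + 1) : ℕ) : ℝ) - 1) * b := by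
    intro z
    have h := norm_framePot_le_of_block (d := d) (n := n) hL (j + 1) Y z hb0 (fun x κ _ => hb x κ)
    rw [hpowR] at h
    exact h
  rw [qvOp_entry_eq hL j hYP i i' t κ, ← mul_add, norm_mul, norm_inv, Complex.norm_natCast, ← div_eq_inv_mul]
  refine div_le_div_of_nonneg_right ((norm_add_le _ _).trans (add_le_add ?_ ?_)) hn0.le
  · exact (norm_apply_le_norm _ i i').trans (hβ _ κ)
  · rw [← Matrix.sub_apply]
    refine (norm_apply_le_norm _ i i').trans ((norm_sub_le _ _).trans ?_)
    rw [two_mul]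
    exact add_le_add (hF _) (hF _)

/-- **THE SAME WITH THE T4 LEVEL DATUM `dirIter L (j+1) 1`** (`= cpushIter L j 1`, `NE3CpushGaugeCovariance.dirIter_succ_eq_cpushIter`). [folklore] -/
theorem norm_qvOp_entry_le_dirIter {L : ℕ} (hL : 1 ≤ L) (j : ℕ) {P : ℕ} [NeZero P] [NeZero (L ^ (j + 1))]
    {Y : Site d → Fin d → Matrix n n ℂ} (hYP : IsPeriodicDir Y ((L ^ (j + 1) * P : ℕ) : ℤ))
    {β : ℝ} (hβ : ∀ (z : Site d) (κ : Fin d), ‖dirIter L (j + 1) (flat (d := d) (n := n)) Y z κ‖ ≤ β)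
    {b : ℝ} (hb : ∀ (y : Site d) (κ : Fin d), ‖Y y κ‖ ≤ b) (i i' : n) (t : Tor (fun _ : Fin d => P)) (κ : Fin d) :
    ‖(QvOp (L ^ (j + 1)) (fun _ : Fin d => P) *ᵥ
        fun p : Tor (fine (L ^ (j + 1)) (fun _ : Fin d => P)) × Fin d =>
          Y (rep (fine (L ^ (j + 1)) (fun _ : Fin d => P)) p.1) p.2 i i') (t, κ)‖
      ≤ (β + 2 * ((d : ℝ) * (((L ^ (j + 1) : ℕ) : ℝ) - 1) * b)) / ((L ^ (j + 1) : ℕ) : ℝ) :=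
  norm_qvOp_entry_le hL j hYP (fun z κ => by rw [← dirIter_succ_eq_cpushIter L j]; exact hβ z κ) hb i i' t κ

end

end Summit.QuantumFields.BalabanUV.T4Continuum.NE7StraightDatumTorus
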